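import Summits.QuantumFields.BalabanUV.Beta.D1BFx.ReducedKernelSandwich

/-!
# `BalabanUV.Beta.D1BFx.MomentTransferParity` — road «BF-x» for binder row D1, leaves K-R5/A4 (supplement): THE PARITY INPUT
# (T1-avg) FROM AN INVERSION SYMMETRY — for a block-periodic two-point kernel that is COVARIANT UNDER AN AFFINE INVERSION
# `P (a₁ − s) (a₂ − s′) = P s s′` and KILLS CONSTANTS (columns sum to zero), the base-point-summed first moments vanish:
# `Σ_{classes b} Σ'_t t_μ · P (b+t) b = 0`; hence the `hT1` hypothesis of `ReducedKernelSandwich.bondSecondMoment_TOfRed_eq_avgM2` is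
# discharged by an inversion covariance of the explicit fine Hessian kernel

HONEST FRAMING (cell contract, verbatim): «discharging `BetaPertH` makes Bałaban's UV stability UNCONDITIONAL — a real
constructive-QFT result; it is NOT the continuum limit and NOT the Clay problem.»  [folklore] bookkeeping of absolutely convergent lattice
sums, composed BY NAME from `MomentTransferPeriodic(Sum)` (residue systems, majorants) and `ReducedKernelSandwich`; it is the block-periodic
analogue of the «midpoint inversion ⇒ (T1)» half of `KernelRepresentationSummable.lowMomentsSum_of_symmetries` (b12).  The inversion
covariance of the road's actual fine Hessian kernel (from the inversion covariance of `S`, `Wf`, `Ga` about the block centre — an5's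
`KernelReflection` sockets) is NOT proved here: it enters as the hypothesis `hinv` on the explicit kernel `fineHess n a S Wf`.  Nothing of the
manuscripts under audit is asserted or cited; no `Prop` fact minted; nothing of D1 / BetaPertH discharged.  Value = kernel bookkeeping leaf
of road BF-x (skeleton `HOME/beta/skeletons/D1-b2b-balaban-beta-d1-p2.md` v1.4 node R5 (T1) «vanishing first moments for the μ ≠ ν channel by
reflection parity»), NOT summit progress; NOT continuum, NOT Clay.  HONEST DEPENDENCY (verbatim): continuum YM on T⁴ ⇐ BetaPertH ∧ nine spine
estimates (0/9 proved); BetaPertH ⇐ (D1) ∧ (D4) ∧ CAP+tail; G-an2-4 gates asym, D1 and NE2/3/4.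

CONTENT (all [folklore]): §1 `resOf_sub_resSite_injective`, `sum_sub_resSite_eq` (NEGATED residue systems), `tsum_firstMoment_reflect`,
**`sum_firstMoment_baseKer_eq_zero_of_inversion`**; §2 the road's corollary **`bondSecondMoment_TOfRed_eq_avgM2_of_inversion`** /
`secondMoment_TOfRed_eq_of_inversion` (hypotheses on the explicit `fineHess`: Ward rows + inversion covariance; NO first-moment hypothesis).
-/

noncomputable section

namespace Summit.QuantumFields.BalabanUV.Beta.D1BFx.MomentTransferParity

open Finset
open scoped BigOperators
open Literature.MathematicalPhysics.QuantumFieldTheory.Balaban1983to89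
open Literature.MathematicalPhysics.QuantumFieldTheory.Balaban1983to89.Beta
open B12Sec2to5 (l1 l1_nonneg)
open ExpKernelCalculus (Site MKer BiLoc shiftK)
open DecimatedMoment (cosetInd)
open DecimatedMomentSummable (AbsMoment₂ IsMoment₂ abs_le_of_isMoment₂ summable_of_absMoment₂)
open DressedMomentNormalisation (resSite resOf dvd_resSite_sub_iff)
open Summit.QuantumFields.BalabanUV.Beta.TameKernelCalculus (Spr)
open Summit.QuantumFields.BalabanUV.Beta.D1BFx.GluonLeg (Ga)
open Summit.QuantumFields.BalabanUV.Beta.D1BFx.ReducedKernel (StencilR TOfRed)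
open Summit.QuantumFields.BalabanUV.Beta.D1BFx.DressedTadpoleTable (Table₂R tableRed)
open Summit.QuantumFields.BalabanUV.Beta.D1BFx.ReducedKernelSandwich (fineHess isBlockPeriodic_fineHess absMoment₂_baseKer_fineHess
  fineHess_transpose bondSecondMoment_TOfRed_eq_avgM2)
open Summit.QuantumFields.BalabanUV.Beta.D1BFx.MomentTransferPeriodic (Ker₂ IsBlockPeriodic baseKer baseKer_add_zsmul
  periodic_apply_eq_resSite)
open Summit.QuantumFields.BalabanUV.Beta.D1BFx.MomentTransferPeriodicSum (periodicMajorant absMoment₂_periodicMajorant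
  abs_baseKer_le_periodicMajorant summable_firstMoment_of_majorant absMoment₂_baseKer_of_majorant)
open Summit.QuantumFields.BalabanUV.Beta.D1BFx.MomentTransferPeriodicEntry (avgM2)

/-! ## §1 Base-point-summed first moments vanish under an affine inversion covariance -/

section Generic

variable {d N : ℕ}

/-- [folklore] NEGATED residue shift is injective: `r ↦ resOf (a − resSite r)` on `Fin d → Fin N` (`0 < N`). -/
theorem resOf_sub_resSite_injective (hN : 0 < N) (a : Fin d → ℤ) :
    Function.Injective (fun r : Fin d → Fin N => resOf hN (a - resSite r)) := by
  intro r₁ r₂ h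
  have h' : resOf hN (a - resSite r₁) = resOf hN (a - resSite r₂) := h
  have h1 : ∀ i, (N : ℤ) ∣ (resSite (resOf hN (a - resSite r₁)) - (a - resSite r₁)) i :=
    (dvd_resSite_sub_iff hN _ _).2 rfl
  have h2 : ∀ i, (N : ℤ) ∣ (resSite (resOf hN (a - resSite r₂)) - (a - resSite r₂)) i :=
    (dvd_resSite_sub_iff hN _ _).2 rfl
  rw [h'] at h1
  funext i
  have hd : (N : ℤ) ∣ ((r₁ i : ℕ) : ℤ) - ((r₂ i : ℕ) : ℤ) := by
    have := dvd_sub (h1 i) (h2 i)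
    have e : (resSite (resOf hN (a - resSite r₂)) - (a - resSite r₁)) i
        - (resSite (resOf hN (a - resSite r₂)) - (a - resSite r₂)) i = ((r₁ i : ℕ) : ℤ) - ((r₂ i : ℕ) : ℤ) := by
      simp only [Pi.sub_apply, resSite]
      ring
    rwa [e] at this
  have hlt : |((r₁ i : ℕ) : ℤ) - ((r₂ i : ℕ) : ℤ)| < (N : ℤ) := by
    have a1 := (r₁ i).isLt
    have a2 := (r₂ i).isLt
    rw [abs_lt]
    constructor <;> omega
  have h0 := Int.eq_zero_of_abs_lt_dvd hd hlt
  exact Fin.ext (by omega)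

/-- [folklore] NEGATED RESIDUE SYSTEMS: a block-periodic function summed over `a − (residue sites)` gives its sum over the residue sites. -/
theorem sum_sub_resSite_eq (hN : 0 < N) {m : (Fin d → ℤ) → ℝ} (hm : ∀ b z : Fin d → ℤ, m (b + (N : ℤ) • z) = m b)
    (a : Fin d → ℤ) : ∑ r : Fin d → Fin N, m (a - resSite r) = ∑ r : Fin d → Fin N, m (resSite r) := by
  have hper : ∀ r : Fin d → Fin N, m (a - resSite r) = m (resSite (resOf hN (a - resSite r))) :=
    fun r => periodic_apply_eq_resSite hN hm _
  simp_rw [hper]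
  exact Function.Bijective.sum_comp
    ((Finite.injective_iff_bijective).1 (resOf_sub_resSite_injective hN a)) (fun r => m (resSite r))

/-- [folklore] ONE BASE POINT: under the inversion covariance `P (a₁ − s) (a₂ − s′) = P s s′`, a vanishing column sum at `a₂ − b` and a
base-point-uniform majorant, `Σ'_t t_μ P (b+t) b = − Σ'_t t_μ P ((a₂ − b) + t) (a₂ − b)`. -/
theorem tsum_firstMoment_reflect {P : Ker₂ d} {a₁ a₂ : Fin d → ℤ} (hinv : ∀ s s', P (a₁ - s) (a₂ - s') = P s s')
    {F : (Fin d → ℤ) → ℝ} (hF : AbsMoment₂ F) (hPF : ∀ b t, |P (b + t) b| ≤ F t)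
    (hcol : ∀ b, HasSum (baseKer P b) 0) (μ : Fin d) (b : Fin d → ℤ) :
    ∑' t, (t μ : ℝ) * baseKer P b t = -∑' t, (t μ : ℝ) * baseKer P (a₂ - b) t := by
  have hsum : ∀ b', Summable (fun t => (t μ : ℝ) * baseKer P b' t) := fun b' => by
    simpa only [zero_smul, sub_zero] using summable_firstMoment_of_majorant hF hPF μ b' 0
  have hsum0 : ∀ b', Summable (baseKer P b') := fun b' =>
    summable_of_absMoment₂ (absMoment₂_baseKer_of_majorant hF hPF b')
  -- rewrite the base-point kernel at `b` through the inversion: displacement `t ↦ (a₁ − a₂) − t`, base point `a₂ − b`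
  have hrefl : ∀ t, baseKer P b t = baseKer P (a₂ - b) ((a₁ - a₂) - t) := by
    intro t
    simp only [baseKer]
    rw [← hinv (b + t) b]
    congr 1
    abel
  calc ∑' t, (t μ : ℝ) * baseKer P b t
      = ∑' t, (t μ : ℝ) * baseKer P (a₂ - b) ((a₁ - a₂) - t) := tsum_congr fun t => by rw [hrefl]
    _ = ∑' t, (((a₁ - a₂) - t) μ : ℝ) * baseKer P (a₂ - b) t := by
        rw [← (Equiv.subLeft (a₁ - a₂)).tsum_eq]
        exact tsum_congr fun t => by simp only [Equiv.subLeft_apply, sub_sub_cancel]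
    _ = ∑' t, ((((a₁ - a₂) μ : ℤ) : ℝ) * baseKer P (a₂ - b) t - (t μ : ℝ) * baseKer P (a₂ - b) t) :=
        tsum_congr fun t => by simp only [Pi.sub_apply, Int.cast_sub]; ring
    _ = (((a₁ - a₂) μ : ℤ) : ℝ) * ∑' t, baseKer P (a₂ - b) t - ∑' t, (t μ : ℝ) * baseKer P (a₂ - b) t := by
        rw [((hsum0 _).mul_left _).tsum_sub (hsum _), tsum_mul_left]
    _ = -∑' t, (t μ : ℝ) * baseKer P (a₂ - b) t := by rw [(hcol (a₂ - b)).tsum_eq, mul_zero, zero_sub]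

/-- [folklore] **(T1-avg) FROM INVERSION COVARIANCE + KILLING CONSTANTS.**  `P` block periodic (`0 < N`), base-point kernels with a
base-point-uniform majorant of absolutely summable second moment, covariant under an affine inversion `P (a₁ − s) (a₂ − s′) = P s s′`, and
with COLUMNS SUMMING TO ZERO at every point: for every `μ`, `Σ_{classes b} Σ'_t t_μ · P (b+t) b = 0`.  (The one-point reflection turns the
class sum into minus the same sum over the negated residue system `a₂ − b`, which is the original one by periodicity; the affine offset
`(a₁ − a₂)_μ` multiplies a column sum, which vanishes.) -/
theorem sum_firstMoment_baseKer_eq_zero_of_inversion (hN : 0 < N) {P : Ker₂ d} (hP : IsBlockPeriodic N P) {a₁ a₂ : Fin d → ℤ}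
    (hinv : ∀ s s', P (a₁ - s) (a₂ - s') = P s s') {F : (Fin d → ℤ) → ℝ} (hF : AbsMoment₂ F) (hPF : ∀ b t, |P (b + t) b| ≤ F t)
    (hcol : ∀ b, HasSum (baseKer P b) 0) (μ : Fin d) :
    ∑ r : Fin d → Fin N, ∑' t, (t μ : ℝ) * baseKer P (resSite r) t = 0 := by
  set S := ∑ r : Fin d → Fin N, ∑' t, (t μ : ℝ) * baseKer P (resSite r) t with hS
  have hm : ∀ b z : Fin d → ℤ, (fun b' => ∑' t, (t μ : ℝ) * baseKer P b' t) (b + (N : ℤ) • z)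
      = (fun b' => ∑' t, (t μ : ℝ) * baseKer P b' t) b := fun b z => by
    simp only [baseKer_add_zsmul hP]
  have h1 : S = -∑ r : Fin d → Fin N, ∑' t, (t μ : ℝ) * baseKer P (a₂ - resSite r) t := by
    rw [hS, ← Finset.sum_neg_distrib]
    exact Finset.sum_congr rfl fun r _ => tsum_firstMoment_reflect hinv hF hPF hcol μ (resSite r)
  have h3 := sum_sub_resSite_eq hN (m := fun b' => ∑' t, (t μ : ℝ) * baseKer P b' t) hm a₂
  rw [h3] at h1
  linarith

end Generic

/-! ## §2 The road's corollary: no first-moment hypothesis for an inversion-covariant fine Hessian kernel -/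

variable (n : ℕ) [NeZero n] (a : ℝ) {S : StencilR} {Wf : Table₂R} {Cs C2 δ : ℝ}

/-- [folklore] **A4 WITH THE PARITY INPUT DISCHARGED BY AN INVERSION COVARIANCE OF THE EXPLICIT KERNEL.**  As
`ReducedKernelSandwich.bondSecondMoment_TOfRed_eq_avgM2`, but the base-point-summed first moments are NOT assumed: instead every entry of
`fineHess n a S Wf` is covariant under an affine inversion `fineHess κ′λ′ (a₁ κ′ − s) (a₂ λ′ − s′) = fineHess κ′λ′ s s′` (bond reflection about
the block centre: offsets may depend on the component).  Together with the Ward rows (`hrow`) this gives (T1-avg) by §1, and the coarse bond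
second moment of the reduced kernel equals the base-point average of the fine second moment. -/
theorem bondSecondMoment_TOfRed_eq_avgM2_of_inversion (hn : 1 ≤ n) (hGa : Spr (Ga n a)) (hS : ∀ κ' u, BiLoc (S κ' u) u u Cs δ)
    (hW : ∀ κ' u l' u', BiLoc (Wf κ' u l' u') u u' C2 δ) (hδ : 0 < δ)
    (hScov : ∀ (κ' : Fin 4) (u v : Site 4), S κ' (u + v) = shiftK (-v) (S κ' u))
    (hWcov : ∀ (κ' : Fin 4) (u : Site 4) (l' : Fin 4) (u' v : Site 4), Wf κ' (u + v) l' (u' + v) = shiftK (-v) (Wf κ' u l' u'))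
    (hWsymm : ∀ (κ' : Fin 4) (u : Site 4) (l' : Fin 4) (u' : Site 4), Wf κ' u l' u' = Wf l' u' κ' u)
    (hrow : ∀ (κ' l' : Fin 4) (b : Site 4), HasSum (fineHess n a S Wf κ' l' b) 0)
    {a₁ a₂ : Fin 4 → Site 4}
    (hinv : ∀ (κ' l' : Fin 4) (s s' : Site 4), fineHess n a S Wf κ' l' (a₁ κ' - s) (a₂ l' - s') = fineHess n a S Wf κ' l' s s')
    (κ lam μ ν : Fin 4) :
    ∑' z : Site 4, ((z κ * z lam : ℤ) : ℝ) * ((n : ℝ) ^ 8 * TOfRed n a S (tableRed n Wf) μ ν z)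
      = avgM2 n (fineHess n a S Wf μ ν) κ lam := by
  have hN : 0 < n := Nat.pos_of_ne_zero (NeZero.ne n)
  have hcol : ∀ (κ' l' : Fin 4) (b : Site 4), HasSum (baseKer (fineHess n a S Wf κ' l') b) 0 := fun κ' l' b =>
    ((Equiv.hasSum_iff (Equiv.addLeft b)).mpr
      ((hrow l' κ' b).congr_fun fun s => fineHess_transpose n a hGa hS hδ hWsymm κ' l' s b)).congr_fun (fun _ => rfl)
  have hT1 : ∀ (κ' l' μ' : Fin 4), ∑ r : Fin 4 → Fin n, ∑' t, (t μ' : ℝ) * baseKer (fineHess n a S Wf κ' l') (resSite r) t = 0 :=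
    fun κ' l' μ' => sum_firstMoment_baseKer_eq_zero_of_inversion hN (isBlockPeriodic_fineHess n a hn hScov hWcov κ' l')
      (hinv κ' l') (absMoment₂_periodicMajorant (absMoment₂_baseKer_fineHess n a hGa hS hW hδ κ' l'))
      (abs_baseKer_le_periodicMajorant hN (isBlockPeriodic_fineHess n a hn hScov hWcov κ' l')) (hcol κ' l') μ'
  exact bondSecondMoment_TOfRed_eq_avgM2 n a hn hGa hS hW hδ hScov hWcov hWsymm hrow hT1 κ lam μ ν

end Summit.QuantumFields.BalabanUV.Beta.D1BFx.MomentTransferParity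

end
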